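import Summits.QuantumFields.YangMills.Theorems.UnitScaleTiltFluctuationComparisonRegPrGlobalSlackKernelLegWeightedV4
import Summits.QuantumFields.YangMills.Theorems.UnitScaleTiltFluctuationComparisonRegPrGlobalSlackKernelLegAnalyticOwn
import HarnessLib

/-!
# `UnitScaleTiltFluctuationComparisonRegPrGlobalSlackKernelLegAnalyticOwnV4` — THE v4 TWIN (★★OWNER RULING g26-№14 (F-2b); P22b display branch, width seat ym-ust-20520-w2 g4; skeleton v5kD; record-free decls imported from `…KernelLegAnalyticOwn`) of `…KernelLegAnalyticOwn` — LEG-WEIGHTED ANALYTICITY (R2′) IN EACH RUN'S OWN INDEXING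
# (crux `FluctuationComparisonRegPrIntL`, stmt-QuantumFields-20520, skeleton v5kC, STUB 3⁗χ; width seat ym-ust-20520-w1 g0, count-neutral helper)

WHY.  In the display-level socket `K1aLegRowsOwnAChiV4` (p585428) the kernel row is lane A's `ChartAnalyticΦ D (rescaleΦw dist κ′ Φ) κ ρ C_A`, which — like every row of record — carries
TWO clauses indexed by run `K`'s localisation domains (run `K`'s rescaled chart at `(b, Y)`, and run `K+1`'s at `(b+1, refineSet Y)` with run `K`'s tree length).  A per-run
record displays ONE clause in its own indexing.  This file gives the own-indexed form and the geometric transfer, as `…KernelLegRefOwn` / `…KernelLegPerRun` did for the other rows: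

* §1 `chartAnalyticityAsCited_mono` (the binder is monotone in its bound), **`ChartAnalyticOwnΦ D Φ κ ρ C_A`** (one clause: for `Y ∈ Loc K k triv (1+b)`, `Φ K b Y` holomorphic on
  `ball 0 ρ`, `≤ C_A e^{−κ𝓛_K(1+b,Y)}` on the half-ball) and **`chartAnalyticΦ_of_own`** (`LocMatched ∧ TreeLenRefinedOn ∧ 0 ≤ κ ∧ 0 ≤ C_A ⟹` the two-clause row: run `K+1`'s
  clause is its own clause at `(K+1, k+1, b+1, refineSet Y)`, with the larger tree length giving the smaller bound);
* §2 the χ-instance for the RESCALED canonical family: `chartAnalyticLegΦ_chiV4_of_own` — so (R2′) of `K1aLegRowsOwnAChiV4` is «`ChartAnalyticOwnΦ D (rescaleΦw (canonLegDist F) κ′ Φ) 𝔠.κ ρ C_A`»,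
  a `∀ K`-statement about run `K`'s charts on run `K`'s own domains (the rescaling `D_w` is run-local: `legD (canonLegDist F) κ′ K b Y`).
HONEST FRAMING: bookkeeping + geometry over hypothesis schemas; nothing of [Balaban1985UV3]/[King1986] asserted; registry untouched; YM₃ on T³ is a rung, not the Clay problem.

References: T. Bałaban, CMP 102 (1985) 255–275 [Balaban1985UV3] ((25) p.262, (29)–(30) p.263, (43) p.266, (45) p.267); CMP 109 (1987) 249–301 [Balaban1987RG1] ((0.1) p.251).
-/

set_option autoImplicit false

noncomputable section

open scoped BigOperators
open Finset Metric
open Literature.MathematicalPhysics.QuantumFieldTheory.Balaban1983to89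
open Literature.MathematicalPhysics.QuantumFieldTheory.Balaban1983to89.T3ContinuumYM3Torus
open Literature.MathematicalPhysics.QuantumFieldTheory.Balaban1983to89.T3UnitScaleTilt
open Literature.MathematicalPhysics.QuantumFieldTheory.Balaban1983to89.T3LevelShift
open Literature.MathematicalPhysics.QuantumFieldTheory.Balaban1983to89.T3AlphaInputsAC
open Literature.MathematicalPhysics.QuantumFieldTheory.Balaban1983to89.T3AlphaPolymerSocket
open Literature.MathematicalPhysics.QuantumFieldTheory.Balaban1983to89.T3AlphaInputsACTwoRun
open Literature.MathematicalPhysics.QuantumFieldTheory.Balaban1983to89.T3AlphaInputsACTwoRunLevel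
open Literature.MathematicalPhysics.QuantumFieldTheory.Balaban1985CMP102
open Literature.MathematicalPhysics.QuantumFieldTheory.Balaban1985CMP102.Setting
open Literature.MathematicalPhysics.QuantumFieldTheory.Balaban1985CMP102.Binders (ChartAnalyticityAsCited)
open Summit.QuantumFields.Balaban3D.Carriers
open Summit.QuantumFields.Balaban3D.Proofs.Primitives
open Summit.QuantumFields.Balaban3D.Proofs.GroupModelLieC (lieC)
open Summit.QuantumFields.YangMills.Theorems
open Summit.QuantumFields.YangMills.Theorems.GlobalSlackKernelMatching
open Summit.QuantumFields.YangMills.Theorems.GlobalSlackCanonicalPolymers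

namespace Summit.QuantumFields.YangMills.Theorems.GlobalSlackKernelLeg

/-! ## §1 The own-indexed analyticity row and its transfer -/

section Own

variable {𝕍 : Type} [NormedAddCommGroup 𝕍] [NormedSpace ℂ 𝕍] {F : T3Family} {γ : ℝ}

-- (record-free `chartAnalyticityAsCited_mono`: imported from the v3 module, not restated)

-- (record-free `ChartAnalyticOwnΦ`: imported from the v3 module, not restated)

-- (record-free `chartAnalyticΦ_of_own`: imported from the v3 module, not restated)

end Own

/-! ## §2 At the χ-record's canonical polymerisation, below the top -/

section Chi

variable {F : T3Family} {𝔠 : AlphaConsts F.L (suGroupModel 2).N} {γ : ℝ} {hγ : 0 < γ} {hγ1 : γ ≤ (min 𝔠.gamma0 1) ^ 2}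

/-- **AT LATTICE LEVELS BELOW THE TOP, RUN `K`'S LISTED DOMAINS REFINE TO RUN `K+1`'S** (the canonical polymerisation; `locMatched_canonRows` in `MapsTo` form): if `k ≤ K` and
`Y ∈ canonLocRows q K k triv (1+b)` then `refineSet Y ∈ canonLocRows q (K+1) (k+1) triv (2+b)` (the listed term levels at lattice level `k` being `≤ k`). [cite: Balaban1987RG1, (0.1) p.251] -/
theorem refineSet_mem_canonLocRows (q : ∀ K, AlphaInputsT3AC.PkgCoreRows F 𝔠 γ hγ hγ1 K) {K k b : ℕ} (hk : k ≤ K) {Y : Set (Site (F.P K) 0)}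
    (hY : Y ∈ canonLocRows q K k (Hist.triv (F.P K) k) (1 + b)) :
    refineSet F K Y ∈ canonLocRows q (K + 1) (k + 1) (Hist.triv (F.P (K + 1)) (k + 1)) (1 + (b + 1)) := by
  classical
  -- `1 + b ≤ k`: the listed term levels at lattice level `k ≤ K` are `≤ k`
  have hbk : 1 + b ≤ k := by
    cases k with
    | zero => simp [canonLocRows] at hY
    | succ j =>
      have hj : j + 1 ≤ K := hk
      by_cases hi : 1 + b = j + 1
      · omega
      · by_cases hi' : 1 + b ∈ Finset.Icc 1 j
        · have := (Finset.mem_Icc.mp hi').2; omega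
        · simp only [canonLocRows, if_pos hj, if_neg hi, if_neg hi'] at hY
          simp at hY
  have hmaps := (locMatched_canonRows q K (K - k) (by omega) (1 + b) (by omega) (by omega)).mapsTo
  rw [show K - (K - k) = k by omega, show K + 1 - (K - k) = k + 1 by omega] at hmaps
  have := hmaps (Finset.mem_coe.mpr hY)
  rw [show 1 + (b + 1) = 1 + b + 1 by ring]
  exact Finset.mem_coe.mp this

/-- **(R2′) OF `K1aLegRowsOwnAChiV4` FROM ITS OWN-INDEXED FORM, at the χ-datum**, given the own row for the RESCALED family at every lattice level and, above the top (`k > K`, the dummy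
whole-torus domain only), the refined clause directly (`hTop`).  Decay `κ ≥ 0` (e.g. `𝔠.κ`), `C_A ≥ 0`. [cite: Balaban1985UV3, (25) p.262, (29)-(30) p.263; Balaban1987RG1, (0.1) p.251] -/
theorem chartAnalyticLegΦ_chiV4_of_own (p : ∀ K, AlphaInputsT3AC.PkgAtV4Chi F 𝔠 γ hγ hγ1 K) {Φ : ChartFam ↥(lieC (suGroupModel 2)) F} {κ' κ ρ C_A : ℝ}
    (hκ : 0 ≤ κ) (hCA : 0 ≤ C_A)
    (hTop : ∀ (K k b : ℕ) (Y : Set (Site (F.P K) 0)), K < k →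
      Y ∈ (AlphaInputsT3AC.dataOfV4chi p (canonPolymerRows fun K => (p K).toRows)).Loc K k
        ((AlphaInputsT3AC.dataOfV4chi p (canonPolymerRows fun K => (p K).toRows)).triv K k) (1 + b) →
      ChartAnalyticityAsCited (rescaleΦw (canonLegDist F) κ' Φ (K + 1) (b + 1) (refineSet F K Y)) ρ
        (C_A * Real.exp (-κ * (AlphaInputsT3AC.dataOfV4chi p (canonPolymerRows fun K => (p K).toRows)).treeLen K (1 + b) Y)))
    (h : ChartAnalyticOwnΦ (AlphaInputsT3AC.dataOfV4chi p (canonPolymerRows fun K => (p K).toRows)) (rescaleΦw (canonLegDist F) κ' Φ) κ ρ C_A) :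
    ChartAnalyticΦ (AlphaInputsT3AC.dataOfV4chi p (canonPolymerRows fun K => (p K).toRows)) (rescaleΦw (canonLegDist F) κ' Φ) κ ρ C_A := by
  refine chartAnalyticΦ_of_own (fun K k b Y hY => ?_) (treeLenRefinedOn_canonRows fun K => (p K).toRows) hκ hCA h
  by_cases hk : k ≤ K
  · exact Or.inl (refineSet_mem_canonLocRows (fun K => (p K).toRows) hk hY)
  · exact Or.inr (hTop K k b Y (by omega) hY)

end Chi

end Summit.QuantumFields.YangMills.Theorems.GlobalSlackKernelLeg

end
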